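import Mathlib.Analysis.Calculus.MeanValue
import Summits.RiemannHypothesis.RiemannHypothesis.Theorems.JensenPolynomialsFarGumbelCenterValue

/-!
# Route `JensenPolynomials`, FAR crux `XiWindowZeroFreeRelFar` (B1-rel far), stub S3 `stub_laplaceFar` — WANTED (L5)
`wanted_value` FROM (L1) (the saddle) AND (L2) (the curvature) (RH-FREE; cell rh-jensen, HUMAN RULING D-0040 / D-0074)

LINE 1 (D-0074 framing): RH-FREE elementary analysis (two first-order mean-value steps for an explicit holomorphic function
on a disc, plus bookkeeping of explicit constants); nothing here bears on the zeros of `ζ` or is progress toward RH.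

`wanted_value_of_saddle_curvature`: for the far mode (`189/20 ≤ υ`, `4πe^{4υ}υ = 2M + 9υ`), `‖a‖ ≤ (9/25)υ²`, the disc
`D = {u : ‖u − u₀‖ ≤ 1/(10υ²)}` about `u₀ = υ + ξ₀/4` (`ξ₀ = farXi0 (farW (a/υ²)) (1/υ)`), IF
(L1) some `u_s ∈ D` has `‖Ψ′(u_s)‖ ≤ 6` and (L2) `Re Ψ″ ≤ −8Λ`, `‖Ψ″‖ ≤ 32Λ` on `D` (`Ψ = farPsi M a`, `Λ = farLam υ`), THEN
for every `u ∈ D`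

  `|Re Ψ(u) + ½(log π − log‖Ψ″(u)/2‖) − farMain M υ (a/υ²)| ≤ Λ/υ³ + 5`

— the text of eng-4 g3's WANTED item (L5) (HOME `eng-4/S3/S3-WANTED.lean` v3, sha16 `d6f8107cd04d985a`). With the tree's
`wanted_curvature` (p456150) and `wanted_saddle` (eng-4 g3, to land) the named item is the one-liner
`wanted_value … := wanted_value_of_saddle_curvature … (wanted_saddle …) (fun u hu => wanted_curvature … u hu) u hu`.

Proof: `Re u > 0` and `Re(u² + a) > 0` on `D`, so `Ψ`, `Ψ′` are holomorphic there (`hasDerivAt_farPsi/1`); by the mean-value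
inequality on the convex disc `‖Ψ′‖ ≤ 6 + 32Λ·2r` on `D` and `‖Ψ(u) − Ψ(u₀)‖ ≤ (6 + 64Λr)·r = 3/(5υ²) + 16Λ/(25υ⁴)`; then
`FarGumbel.re_farPsi_center_bookkeeping` (p457804) turns the statement into `|ΔΨ + Re G + ½log(16Λ‖w‖/‖Ψ″(u)‖)|` with
`‖G‖ ≤ 1` (`norm_farGumbelG_le`) and `16Λ‖w‖/‖Ψ″(u)‖ ∈ [25/68, 25/8]` (`‖w‖ ∈ [25/34, 25/16]`), `|log| ≤ 17/8`.
WHAT THIS IS NOT: nothing about `ξ` or `ζ`. References: theory g8's S3-BLUEPRINT §4 ledger; GORZ 2019 [GORZPNAS2019].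
-/

noncomputable section
-- D-0017: `Summit.RiemannHypothesis.RiemannHypothesis.…` duplicates the namespace BY DESIGN (single-problem summit).
set_option linter.dupNamespace false

namespace Summit.RiemannHypothesis.RiemannHypothesis.Theorems.JensenPolynomials.FarGumbel

open Complex Metric
open scoped Real

/-- The saddle disc lies in the half-strip of holomorphy: for `‖u − u₀‖ ≤ 1/(10υ²)` (`u₀ = υ + ξ₀/4`, `‖ξ₀‖ ≤ 3/5`),
`Re u > 0` and `Re(u² + a) > 0`, so `u² + a ∈ slitPlane`. -/
theorem saddleDisc_domain {υ : ℝ} (hυ : (189 / 20 : ℝ) ≤ υ) {a : ℂ} (ha : ‖a‖ ≤ (9 / 25 : ℝ) * υ ^ 2) {u : ℂ}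
    (hu : ‖u - ((υ : ℂ) + farXi0 (farW (a / (υ : ℂ) ^ 2)) (1 / υ) / 4)‖ ≤ 1 / (10 * υ ^ 2)) :
    0 < u.re ∧ u ^ 2 + a ∈ Complex.slitPlane := by
  have hυpos : 0 < υ := by linarith
  have hυ2 : (89 : ℝ) ≤ υ ^ 2 := by nlinarith
  have hz : ‖a / (υ : ℂ) ^ 2‖ ≤ (9 / 25 : ℝ) := by
    rw [norm_div, norm_pow, Complex.norm_real, Real.norm_of_nonneg hυpos.le, div_le_iff₀ (by positivity)]
    exact ha
  have hε : (0 : ℝ) < 1 / υ := by positivity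
  have hε' : 1 / υ ≤ 20 / 189 := by rw [div_le_div_iff₀ hυpos (by norm_num)]; linarith
  have hξ := norm_farXi0_le hz hε hε'
  set ξ₀ := farXi0 (farW (a / (υ : ℂ) ^ 2)) (1 / υ) with hξdef
  have hr : 1 / (10 * υ ^ 2) ≤ (1 : ℝ) / 890 := by
    rw [div_le_div_iff₀ (by positivity) (by norm_num)]; nlinarith
  -- `u − υ = ξ₀/4 + (u − u₀)` has norm ≤ 3/20 + 1/890
  have hd : ‖u - (υ : ℂ)‖ ≤ 3 / 20 + 1 / 890 := by
    have e1 : u - (υ : ℂ) = ξ₀ / 4 + (u - ((υ : ℂ) + ξ₀ / 4)) := by ring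
    rw [e1]
    calc ‖ξ₀ / 4 + (u - ((υ : ℂ) + ξ₀ / 4))‖ ≤ ‖ξ₀ / 4‖ + ‖u - ((υ : ℂ) + ξ₀ / 4)‖ := norm_add_le _ _
      _ ≤ 3 / 20 + 1 / 890 := by
          have h4 : ‖ξ₀ / 4‖ ≤ 3 / 20 := by
            rw [norm_div]
            have : ‖(4 : ℂ)‖ = 4 := by norm_num
            rw [this]; linarith
          linarith
  have hdre : |u.re - υ| ≤ 3 / 20 + 1 / 890 := by
    have := abs_re_le_norm (u - (υ : ℂ))
    simp only [Complex.sub_re, Complex.ofReal_re] at this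
    linarith
  have hdim : |u.im| ≤ 3 / 20 + 1 / 890 := by
    have := abs_im_le_norm (u - (υ : ℂ))
    simp only [Complex.sub_im, Complex.ofReal_im, sub_zero] at this
    linarith
  obtain ⟨hre1, hre2⟩ := abs_le.1 hdre
  obtain ⟨him1, him2⟩ := abs_le.1 hdim
  have hure : 9 < u.re := by linarith
  refine ⟨by linarith, ?_⟩
  rw [Complex.mem_slitPlane_iff]
  left
  have hare : -(9 / 25 * υ ^ 2) ≤ a.re := by
    have := abs_re_le_norm a
    linarith [(abs_le.1 (this.trans ha)).1]
  have e1 : (u ^ 2 + a).re = u.re ^ 2 - u.im ^ 2 + a.re := by simp [pow_two, Complex.mul_re]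
  rw [e1]
  nlinarith

set_option maxHeartbeats 400000 in
/-- **(L5) from (L1) and (L2).** For the far mode, `‖a‖ ≤ (9/25)υ²` and the disc `‖u − u₀‖ ≤ 1/(10υ²)`: if some `u_s` in the
disc has `‖Ψ′(u_s)‖ ≤ 6` and `Re Ψ″ ≤ −8Λ`, `‖Ψ″‖ ≤ 32Λ` on the disc, then
`|Re Ψ(u) + ½(log π − log‖Ψ″(u)/2‖) − farMain M υ (a/υ²)| ≤ Λ/υ³ + 5` for every `u` in the disc. -/
theorem wanted_value_of_saddle_curvature (M : ℕ) (υ : ℝ)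
    (hυ : (189 / 20 : ℝ) ≤ υ ∧ 4 * Real.pi * Real.exp (4 * υ) * υ = 2 * (M : ℝ) + 9 * υ)
    (a : ℂ) (ha : ‖a‖ ≤ (9 / 25 : ℝ) * υ ^ 2)
    (hsad : ∃ u_s : ℂ, ‖u_s - ((υ : ℂ) + farXi0 (farW (a / (υ : ℂ) ^ 2)) (1 / υ) / 4)‖ ≤ 1 / (10 * υ ^ 2) ∧
      ‖farPsi1 M a u_s‖ ≤ 6)
    (hcurv : ∀ u : ℂ, ‖u - ((υ : ℂ) + farXi0 (farW (a / (υ : ℂ) ^ 2)) (1 / υ) / 4)‖ ≤ 1 / (10 * υ ^ 2) →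
      (farPsi2 M a u).re ≤ -8 * farLam υ ∧ ‖farPsi2 M a u‖ ≤ 32 * farLam υ)
    (u : ℂ) (hu : ‖u - ((υ : ℂ) + farXi0 (farW (a / (υ : ℂ) ^ 2)) (1 / υ) / 4)‖ ≤ 1 / (10 * υ ^ 2)) :
    |(farPsi M a u).re + 1 / 2 * (Real.log π - Real.log ‖farPsi2 M a u / 2‖) - farMain M υ (a / (υ : ℂ) ^ 2)| ≤
      farLam υ / υ ^ 3 + 5 := by
  have hυ0 : (189 / 20 : ℝ) ≤ υ := hυ.1
  have hυpos : 0 < υ := by linarith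
  have hυ2 : (89 : ℝ) ≤ υ ^ 2 := by nlinarith
  set Λ : ℝ := farLam υ with hΛdef
  have hΛpos : 0 < Λ := by rw [hΛdef, farLam]; positivity
  set z : ℂ := a / (υ : ℂ) ^ 2 with hzdef
  have hz : ‖z‖ ≤ (9 / 25 : ℝ) := by
    rw [hzdef, norm_div, norm_pow, Complex.norm_real, Real.norm_of_nonneg hυpos.le, div_le_iff₀ (by positivity)]
    exact ha
  obtain ⟨h1z, hw, _, _⟩ := farW_facts hz
  set w : ℂ := farW z with hwdef
  have hw' : 25 / 34 ≤ ‖w‖ := by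
    have hn2 : ‖1 + z‖ ≤ 34 / 25 := by
      have h := norm_add_le (1 : ℂ) z
      simp only [norm_one] at h
      linarith
    rw [hwdef, farW, norm_inv]
    calc (25 : ℝ) / 34 = ((34 : ℝ) / 25)⁻¹ := by norm_num
      _ ≤ ‖1 + z‖⁻¹ := inv_anti₀ (norm_pos_iff.2 h1z) hn2
  set u₀ : ℂ := (υ : ℂ) + farXi0 w (1 / υ) / 4 with hu0def
  set r : ℝ := 1 / (10 * υ ^ 2) with hrdef
  have hrpos : 0 < r := by positivity
  have hr : r ≤ 1 / 890 := by
    rw [hrdef, div_le_div_iff₀ (by positivity) (by norm_num)]; nlinarith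
  -- the disc and holomorphy on it
  set D : Set ℂ := closedBall u₀ r with hDdef
  have hD : Convex ℝ D := convex_closedBall _ _
  have hmem : ∀ v : ℂ, ‖v - u₀‖ ≤ r ↔ v ∈ D := fun v => by rw [hDdef, mem_closedBall, dist_eq_norm]
  have hdom : ∀ v ∈ D, 0 < v.re ∧ v ^ 2 + a ∈ Complex.slitPlane := fun v hv =>
    saddleDisc_domain hυ0 ha ((hmem v).2 hv)
  have hd1 : ∀ v ∈ D, HasDerivWithinAt (farPsi M a) (farPsi1 M a v) D v := fun v hv =>
    (hasDerivAt_farPsi M a (hdom v hv).1 (hdom v hv).2).hasDerivWithinAt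
  have hd2 : ∀ v ∈ D, HasDerivWithinAt (farPsi1 M a) (farPsi2 M a v) D v := fun v hv =>
    (hasDerivAt_farPsi1 M a (hdom v hv).1 (hdom v hv).2).hasDerivWithinAt
  have hu' : u ∈ D := (hmem u).1 hu
  have hu0' : u₀ ∈ D := by rw [hDdef]; exact mem_closedBall_self hrpos.le
  -- (L1) + (L2) ⇒ `‖Ψ′‖ ≤ 6 + 64Λr` on the disc
  obtain ⟨u_s, hus, hus6⟩ := hsad
  have hus' : u_s ∈ D := (hmem u_s).1 hus
  have hb2 : ∀ v ∈ D, ‖farPsi2 M a v‖ ≤ 32 * Λ := fun v hv => (hcurv v ((hmem v).2 hv)).2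
  have hb1 : ∀ v ∈ D, ‖farPsi1 M a v‖ ≤ 6 + 64 * Λ * r := by
    intro v hv
    have h := hD.norm_image_sub_le_of_norm_hasDerivWithin_le hd2 hb2 hus' hv
    have hvs : ‖v - u_s‖ ≤ 2 * r := by
      calc ‖v - u_s‖ = ‖(v - u₀) - (u_s - u₀)‖ := by ring_nf
        _ ≤ ‖v - u₀‖ + ‖u_s - u₀‖ := norm_sub_le _ _
        _ ≤ r + r := add_le_add ((hmem v).2 hv) hus
        _ = 2 * r := by ring
    calc ‖farPsi1 M a v‖ = ‖(farPsi1 M a v - farPsi1 M a u_s) + farPsi1 M a u_s‖ := by ring_nf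
      _ ≤ ‖farPsi1 M a v - farPsi1 M a u_s‖ + ‖farPsi1 M a u_s‖ := norm_add_le _ _
      _ ≤ 32 * Λ * ‖v - u_s‖ + 6 := add_le_add h hus6
      _ ≤ 32 * Λ * (2 * r) + 6 := by gcongr
      _ = 6 + 64 * Λ * r := by ring
  -- ⇒ `‖Ψ(u) − Ψ(u₀)‖ ≤ (6 + 64Λr)·r`
  have hΔ : ‖farPsi M a u - farPsi M a u₀‖ ≤ (6 + 64 * Λ * r) * r := by
    have h := hD.norm_image_sub_le_of_norm_hasDerivWithin_le hd1 hb1 hu0' hu'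
    calc ‖farPsi M a u - farPsi M a u₀‖ ≤ (6 + 64 * Λ * r) * ‖u - u₀‖ := h
      _ ≤ (6 + 64 * Λ * r) * r := by gcongr
  have hΔre : |(farPsi M a u).re - (farPsi M a u₀).re| ≤ (6 + 64 * Λ * r) * r := by
    have := abs_re_le_norm (farPsi M a u - farPsi M a u₀)
    rw [Complex.sub_re] at this
    exact this.trans hΔ
  -- (L2) at `u`: `X = ‖Ψ″(u)‖ ∈ [8Λ, 32Λ]`
  obtain ⟨hcre, hcn⟩ := hcurv u hu
  set X : ℝ := ‖farPsi2 M a u‖ with hXdef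
  have hX8 : 8 * Λ ≤ X := by
    have := abs_re_le_norm (farPsi2 M a u)
    have h' : |(farPsi2 M a u).re| ≥ 8 * Λ := by
      rw [ge_iff_le, le_abs]; right; linarith
    linarith
  have hXpos : 0 < X := by linarith
  have hX2 : ‖farPsi2 M a u / 2‖ = X / 2 := by rw [norm_div, Complex.norm_two]
  -- the bookkeeping identity at the centre
  have hbook := re_farPsi_center_bookkeeping M hυ ha hXpos
  have hG := norm_farGumbelG_le hz hυ0
  set G : ℂ := 9 * farXi0 (farW (a / (υ : ℂ) ^ 2)) (1 / υ) / 4 +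
      Complex.log (1 + ((1 / υ : ℝ) : ℂ) * farXi0 (farW (a / (υ : ℂ) ^ 2)) (1 / υ) / 4) -
      (9 * (υ : ℂ) + 1) / 2 * Complex.log (1 + farW (a / (υ : ℂ) ^ 2) *
        (((1 / υ : ℝ) : ℂ) * farXi0 (farW (a / (υ : ℂ) ^ 2)) (1 / υ) / 2 +
          ((1 / υ : ℝ) : ℂ) ^ 2 * farXi0 (farW (a / (υ : ℂ) ^ 2)) (1 / υ) ^ 2 / 16)) with hGdef
  have hGre : |G.re| ≤ 1 := (abs_re_le_norm G).trans hG
  -- the logarithm of the ratio `16Λ‖w‖/X ∈ [25/68, 25/8]`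
  set R : ℝ := 16 * Λ * ‖w‖ / X with hRdef
  have hRpos : 0 < R := by rw [hRdef]; positivity
  have hRle : R ≤ 25 / 8 := by
    rw [hRdef, div_le_iff₀ hXpos]
    calc 16 * Λ * ‖w‖ ≤ 16 * Λ * (25 / 16) := by gcongr
      _ = 25 / 8 * (8 * Λ) := by ring
      _ ≤ 25 / 8 * X := by gcongr
  have hRge : 25 / 68 ≤ R := by
    rw [hRdef, le_div_iff₀ hXpos]
    calc 25 / 68 * X ≤ 25 / 68 * (32 * Λ) := by gcongr
      _ = 16 * Λ * (25 / 34) := by ring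
      _ ≤ 16 * Λ * ‖w‖ := by gcongr
  have hlogR : |Real.log R| ≤ 17 / 8 := by
    rw [abs_le]
    constructor
    · have := Real.one_sub_inv_le_log_of_pos hRpos
      have hinv : R⁻¹ ≤ 68 / 25 := by
        rw [inv_le_comm₀ hRpos (by norm_num)]; linarith
      linarith
    · have := Real.log_le_sub_one_of_pos hRpos
      linarith
  -- assemble
  have hsize : (6 + 64 * Λ * r) * r ≤ Λ / υ ^ 3 + 1 := by
    have e1 : (6 + 64 * Λ * r) * r = 6 * r + 64 * Λ * r ^ 2 := by ring
    rw [e1]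
    have h1 : 6 * r ≤ 1 := by linarith
    have h2 : 64 * Λ * r ^ 2 ≤ Λ / υ ^ 3 := by
      rw [hrdef]
      rw [show 64 * Λ * (1 / (10 * υ ^ 2)) ^ 2 = Λ * (16 / 25) / υ ^ 4 by field_simp; ring]
      rw [div_le_div_iff₀ (by positivity) (by positivity)]
      have : Λ * (16 / 25) * υ ^ 3 ≤ Λ * υ ^ 3 * 1 := by nlinarith [pow_pos hυpos 3]
      nlinarith [pow_pos hυpos 3]
    linarith
  have key : (farPsi M a u).re + 1 / 2 * (Real.log π - Real.log ‖farPsi2 M a u / 2‖) - farMain M υ (a / (υ : ℂ) ^ 2) =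
      ((farPsi M a u).re - (farPsi M a u₀).re) + (G.re + 1 / 2 * Real.log R) := by
    rw [hX2]
    have hb : (farPsi M a u₀).re + 1 / 2 * (Real.log π - Real.log (X / 2)) - farMain M υ (a / (υ : ℂ) ^ 2) =
        G.re + 1 / 2 * Real.log R := hbook
    linarith
  rw [key]
  calc |((farPsi M a u).re - (farPsi M a u₀).re) + (G.re + 1 / 2 * Real.log R)|
      ≤ |(farPsi M a u).re - (farPsi M a u₀).re| + |G.re + 1 / 2 * Real.log R| := abs_add_le _ _
    _ ≤ (Λ / υ ^ 3 + 1) + (1 + 1 / 2 * (17 / 8)) := by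
        gcongr
        · exact hΔre.trans hsize
        · calc |G.re + 1 / 2 * Real.log R| ≤ |G.re| + |1 / 2 * Real.log R| := abs_add_le _ _
            _ ≤ 1 + 1 / 2 * (17 / 8) := by
                rw [abs_mul, abs_of_pos (by norm_num : (0 : ℝ) < 1 / 2)]
                linarith
    _ ≤ Λ / υ ^ 3 + 5 := by linarith

end Summit.RiemannHypothesis.RiemannHypothesis.Theorems.JensenPolynomials.FarGumbel

end
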